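import Literature.Probability.RandomPlanarGeometry.USTPeanoTreeBijection
import HarnessLib

/-!
# Peeling along a prefix: the Markov property of Peano paths at time `n` ([LSW04] Lemma 4.1)

G. F. Lawler, O. Schramm, W. Werner, Ann. Probab. **32** (2004), Lemma 4.1 (p. 972): "Let
`1 ≤ n ≤ ℓ`. Conditioned on `γ[0, n] = (γ(0), …, γ(n))`, the distribution of the remaining path
is the same as that of the UST Peano path from `γ(n)` to `b` in `D_n = D(α_n, β_n, γ(n), b)`."

The one-step peeling (`peelE`, `peelP`, `pathSplit`, `USTPeanoMarkov.lean`) is iterated along a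
prefix `a, q₁, …, q_n` of the path (`PeelData.peelAlong`): the peeled data stay good and the
remainder `γ[n, ℓ+1]` is a Peano path of them (`Good.peelAlong`, `IsPath.drop_peelAlong`, `peelAlong_a`), and
**the Peano paths of `S` with the prefix `a, q₁, …, q_n` correspond exactly to the Peano paths of
the peeled data `S.peelAlong [q₁, …, q_n]`** (`Good.prefixEquiv`, by `γ ↦ γ[n, ℓ+1]`) — so that,
the UST Peano path being uniform (`USTPeanoPath.lean`), its conditional law given the prefix is
the uniform law on the Peano paths of the peeled data (`Good.card_prefix_eq`).  On the tree side
(`Good.pathForestEquiv`, `USTPeanoTreeBijection.lean`), off the roots of the peeled data the tree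
`T(γ)` is the tree of the remainder, and on them it is determined by the prefix
(`Good.pathForestEquiv_parent_peelAlong`, `Good.pathForestEquiv_parent_eq_of_prefix`).
-/

namespace Literature.Probability.RandomPlanarGeometry

namespace USTPeano

open Literature.Probability.LatticeModels

namespace PeelData

variable {P₀ : Finset (ℤ × ℤ)} {S : PeelData}

/-! ### Peeling along a prefix -/

/-- **Peeling along the prefix** `a → q₁ → ⋯ → q_n` (given as the list `[q₁, …, q_n]`): peel the
first vertex along the dual or the primal step according to `q₁`, and continue.
[cite: LawlerSchrammWerner2004, Lemma 4.1] -/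
def peelAlong : PeelData → List (ℤ × ℤ) → PeelData
  | S, [] => S
  | S, q :: w => if q = stepD S.a then peelAlong S.peelE w else peelAlong S.peelP w

/-- Peeling along the empty prefix. [folklore] -/
@[simp] theorem peelAlong_nil (S : PeelData) : S.peelAlong [] = S := rfl

/-- Peeling along a prefix starting with the dual step. [folklore] -/
theorem peelAlong_cons_of_eq (S : PeelData) {q : ℤ × ℤ} (w : List (ℤ × ℤ)) (hq : q = stepD S.a) :
    S.peelAlong (q :: w) = S.peelE.peelAlong w := by
  rw [peelAlong, if_pos hq]

/-- Peeling along a prefix starting with the primal step. [folklore] -/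
theorem peelAlong_cons_of_ne (S : PeelData) {q : ℤ × ℤ} (w : List (ℤ × ℤ)) (hq : q ≠ stepD S.a) :
    S.peelAlong (q :: w) = S.peelP.peelAlong w := by
  rw [peelAlong, if_neg hq]

/-- Peeling along a concatenation. [folklore] -/
theorem peelAlong_append : ∀ (S : PeelData) (w w' : List (ℤ × ℤ)),
    S.peelAlong (w ++ w') = (S.peelAlong w).peelAlong w'
  | _, [], _ => rfl
  | S, q :: w, w' => by
    by_cases hq : q = stepD S.a
    · rw [List.cons_append, peelAlong_cons_of_eq _ _ hq, peelAlong_cons_of_eq _ _ hq,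
        peelAlong_append]
    · rw [List.cons_append, peelAlong_cons_of_ne _ _ hq, peelAlong_cons_of_ne _ _ hq,
        peelAlong_append]

/-- The final vertex is unchanged. [folklore] -/
@[simp] theorem peelAlong_b : ∀ (S : PeelData) (w : List (ℤ × ℤ)), (S.peelAlong w).b = S.b
  | _, [] => rfl
  | S, q :: w => by
    by_cases hq : q = stepD S.a
    · rw [peelAlong_cons_of_eq _ _ hq, peelAlong_b, peelE_b]
    · rw [peelAlong_cons_of_ne _ _ hq, peelAlong_b, peelP_b]

/-! ### The second vertex of a Peano path -/

/-- The second vertex of a Peano path with a given prefix. [folklore] -/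
theorem IsPath.tail_eq_cons_of_prefix {γ : List (ℤ × ℤ)} {q : ℤ × ℤ} {w : List (ℤ × ℤ)}
    (hw : q :: w <+: γ.tail) : ∃ t, γ.tail = q :: t ∧ w <+: t :=
  List.cons_prefix_iff.1 hw

/-- The second vertex of a Peano path is interior, unless it is `b`. [folklore] -/
theorem IsPath.head_tail_mem_V (h : S.Good) {γ : List (ℤ × ℤ)} (hγ : S.IsPath γ)
    (hb : γ.tail.head (hγ.tail_ne_nil h) ≠ S.b) : γ.tail.head (hγ.tail_ne_nil h) ∈ S.V := by
  have hmem : γ.tail.head (hγ.tail_ne_nil h) ∈ γ := List.mem_of_mem_tail (List.head_mem _)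
  rcases (hγ.mem_iff _).1 hmem with h1 | h1 | h1
  · exfalso
    have hnd := hγ.nodup
    rw [hγ.eq_cons, List.nodup_cons] at hnd
    exact hnd.1 (h1 ▸ List.head_mem _)
  · exact absurd h1 hb
  · exact h1

/-! ### The peeled data along a prefix are good, and the remainder is a Peano path -/

/-- **Peeling along a prefix of a Peano path keeps the data good, and the remainder of the path
is a Peano path of the peeled data** ([LSW04] Lemma 4.1, iterated): for a Peano path `γ` of good
data `S` and a prefix `a, q₁, …, q_n` of `γ` not reaching `b`; the new initial vertex is `q_n`.
[cite: LawlerSchrammWerner2004, Lemma 4.1] -/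
theorem peelAlong_spec : ∀ (w : List (ℤ × ℤ)) (S : PeelData), S.Good →
    ∀ γ : List (ℤ × ℤ), S.IsPath γ → w <+: γ.tail → S.b ∉ w →
      (S.peelAlong w).Good ∧ (S.peelAlong w).IsPath (γ.drop w.length) ∧
        (S.peelAlong w).a = (S.a :: w).getLast (List.cons_ne_nil _ _)
  | [], S, h, γ, hγ, _, _ => ⟨h, by simpa using hγ, rfl⟩
  | q :: w, S, h, γ, hγ, hw, hb => by
    obtain ⟨t, ht, hwt⟩ := List.cons_prefix_iff.1 hw
    have hne : γ.tail ≠ [] := hγ.tail_ne_nil h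
    have hq : γ.tail.head hne = q := by simp [ht]
    have hqb : q ≠ S.b := fun e ↦ hb (e ▸ List.mem_cons_self)
    have hqV : q ∈ S.V := hq ▸ hγ.head_tail_mem_V h (hq ▸ hqb)
    have hV : S.V ≠ ∅ := Finset.ne_empty_of_mem hqV
    have hb' : S.b ∉ w := fun h' ↦ hb (List.mem_cons_of_mem _ h')
    have hwt' : w <+: γ.tail.tail := by rw [ht]; exact hwt
    rw [List.length_cons, ← List.drop_tail, List.getLast_cons_cons]
    rcases hγ.head_tail h with hd | hp
    · have hqd : q = stepD S.a := hq.symm.trans hd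
      rw [peelAlong_cons_of_eq _ _ hqd]
      have hE : S.CanE := hγ.cons_tail.canE_of_head h hne hd
      have IH := peelAlong_spec w S.peelE (h.peelE hE (h.stepD_ne_b hV hE)) γ.tail
        (hγ.cons_tail.tail_peelE h hne hd) hwt' hb'
      rw [peelE_a, ← hqd] at IH
      exact IH
    · have hqd : q ≠ stepD S.a := fun e ↦ stepD_ne_stepP S.a (e.symm.trans (hq.symm.trans hp))
      rw [peelAlong_cons_of_ne _ _ hqd]
      have hE' : S.swap.CanE := hγ.swap_canE_of_head_stepP h hp
      have hb'' : stepD S.swap.a ≠ S.swap.b := h.swap.stepD_ne_b (swap_V_ne_empty hV) hE'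
      have IH := peelAlong_spec w S.peelP (h.peelP_good hE' hb'') γ.tail
        (hγ.tail_peelP h hp) hwt' (by rwa [peelP_b])
      rw [peelP_a, ← hq.symm.trans hp] at IH
      exact IH

/-- The peeled data along a prefix of a Peano path (not reaching `b`) are good.
[cite: LawlerSchrammWerner2004, Lemma 4.1] -/
theorem Good.peelAlong (h : S.Good) {γ : List (ℤ × ℤ)} (hγ : S.IsPath γ) {w : List (ℤ × ℤ)}
    (hw : w <+: γ.tail) (hb : S.b ∉ w) : (S.peelAlong w).Good :=
  (peelAlong_spec w S h γ hγ hw hb).1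

/-- **The remainder `γ[n, ℓ+1]` of a Peano path after a prefix of length `n` is a Peano path of
the data peeled along the prefix.** [cite: LawlerSchrammWerner2004, Lemma 4.1] -/
theorem IsPath.drop_peelAlong (h : S.Good) {γ : List (ℤ × ℤ)} (hγ : S.IsPath γ) {w : List (ℤ × ℤ)}
    (hw : w <+: γ.tail) (hb : S.b ∉ w) : (S.peelAlong w).IsPath (γ.drop w.length) :=
  (peelAlong_spec w S h γ hγ hw hb).2.1

/-- The initial vertex of the data peeled along a prefix `a, q₁, …, q_n` of a Peano path is
`q_n` (`a` for the empty prefix). [folklore] -/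
theorem peelAlong_a (h : S.Good) {γ : List (ℤ × ℤ)} (hγ : S.IsPath γ) {w : List (ℤ × ℤ)}
    (hw : w <+: γ.tail) (hb : S.b ∉ w) :
    (S.peelAlong w).a = (S.a :: w).getLast (List.cons_ne_nil _ _) :=
  (peelAlong_spec w S h γ hγ hw hb).2.2

/-! ### The Peano paths with a given prefix are the Peano paths of the peeled data -/

/-- After a primal first step, a Peano path of `S.peelP` extends back to a Peano path of `S`.
[cite: LawlerSchrammWerner2004, Lemma 4.1] -/
theorem IsPath.cons_peelP (h : S.Good) (hE' : S.swap.CanE) (hb' : stepD S.swap.a ≠ S.swap.b)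
    {l : List (ℤ × ℤ)} (hl : S.peelP.IsPath l) : S.IsPath (S.a :: l) := by
  have h1 : S.swap.peelE.IsPath (l.map swapIdx) := by
    have := hl.swap
    rwa [peelP_eq, swap_swap] at this
  have h2 := (IsPath.cons_peelE h.swap hE' hb' h1).of_swap
  simp only [List.map_cons, swap_a, swapIdx_swapIdx, map_swapIdx_map_swapIdx] at h2
  exact h2

/-- Peano paths along an equality of peeling data. [folklore] -/
def pathsCast {S₁ S₂ : PeelData} (e : S₁ = S₂) : {l // S₁.IsPath l} ≃ {l // S₂.IsPath l} :=
  Equiv.subtypeEquivRight fun l ↦ by rw [e]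

/-- `pathsCast` keeps the vertex list. [folklore] -/
@[simp] theorem pathsCast_apply_val {S₁ S₂ : PeelData} (e : S₁ = S₂) (γ : {l // S₁.IsPath l}) :
    (pathsCast e γ).1 = γ.1 := rfl

/-- `pathsCast.symm` keeps the vertex list. [folklore] -/
@[simp] theorem pathsCast_symm_apply_val {S₁ S₂ : PeelData} (e : S₁ = S₂) (γ : {l // S₂.IsPath l}) :
    ((pathsCast e).symm γ).1 = γ.1 := rfl

/-- **One dual step**: the Peano paths of `S` starting `a → stepD a → w…` are the Peano paths of
`S.peelE` starting `stepD a → w…` (drop `a`). [cite: LawlerSchrammWerner2004, Lemma 4.1] -/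
def Good.prefixStepEquivE (h : S.Good) (hV : S.V ≠ ∅) (hE : S.CanE) (w : List (ℤ × ℤ)) :
    {γ // S.IsPath γ ∧ stepD S.a :: w <+: γ.tail} ≃ {γ // S.peelE.IsPath γ ∧ w <+: γ.tail} where
  toFun γ := ⟨γ.1.tail, by
      obtain ⟨t, ht, -⟩ := List.cons_prefix_iff.1 γ.2.2
      have hne : γ.1.tail ≠ [] := γ.2.1.tail_ne_nil h
      have hd : γ.1.tail.head hne = stepD S.a := by simp [ht]
      exact γ.2.1.cons_tail.tail_peelE h hne hd, by
      obtain ⟨t, ht, hwt⟩ := List.cons_prefix_iff.1 γ.2.2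
      rw [ht]
      exact hwt⟩
  invFun γ := ⟨S.a :: γ.1, IsPath.cons_peelE h hE (h.stepD_ne_b hV hE) γ.2.1, by
    rw [List.tail_cons]
    conv_rhs => rw [γ.2.1.eq_cons]
    exact List.cons_prefix_cons.2 ⟨rfl, γ.2.2⟩⟩
  left_inv γ := Subtype.ext γ.2.1.eq_cons.symm
  right_inv _ := rfl

/-- **One primal step**: the Peano paths of `S` starting `a → stepP a → w…` are the Peano paths of
`S.peelP` starting `stepP a → w…`. [cite: LawlerSchrammWerner2004, Lemma 4.1] -/
def Good.prefixStepEquivP (h : S.Good) (hV : S.V ≠ ∅) (hE' : S.swap.CanE) (w : List (ℤ × ℤ)) :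
    {γ // S.IsPath γ ∧ stepP S.a :: w <+: γ.tail} ≃ {γ // S.peelP.IsPath γ ∧ w <+: γ.tail} where
  toFun γ := ⟨γ.1.tail, by
      obtain ⟨t, ht, -⟩ := List.cons_prefix_iff.1 γ.2.2
      have hne : γ.1.tail ≠ [] := γ.2.1.tail_ne_nil h
      have hp : γ.1.tail.head hne = stepP S.a := by simp [ht]
      exact γ.2.1.tail_peelP h hp, by
      obtain ⟨t, ht, hwt⟩ := List.cons_prefix_iff.1 γ.2.2
      rw [ht]
      exact hwt⟩
  invFun γ := ⟨S.a :: γ.1,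
    IsPath.cons_peelP h hE' (h.swap.stepD_ne_b (swap_V_ne_empty hV) hE') γ.2.1, by
    rw [List.tail_cons]
    conv_rhs => rw [γ.2.1.eq_cons]
    rw [peelP_a]
    exact List.cons_prefix_cons.2 ⟨rfl, γ.2.2⟩⟩
  left_inv γ := Subtype.ext γ.2.1.eq_cons.symm
  right_inv _ := rfl

/-- What a Peano path with the prefix `a, q, w…` tells about the first step. [folklore] -/
theorem Good.first_step_facts (h : S.Good) {q : ℤ × ℤ} {w γ : List (ℤ × ℤ)} (hγ : S.IsPath γ)
    (hw : q :: w <+: γ.tail) (hb : S.b ∉ q :: w) :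
    S.V ≠ ∅ ∧ ((q = stepD S.a ∧ S.CanE) ∨ (q = stepP S.a ∧ S.swap.CanE)) := by
  obtain ⟨t, ht, -⟩ := List.cons_prefix_iff.1 hw
  have hne : γ.tail ≠ [] := hγ.tail_ne_nil h
  have hq : γ.tail.head hne = q := by simp [ht]
  have hqb : q ≠ S.b := fun e ↦ hb (e ▸ List.mem_cons_self)
  have hqV : q ∈ S.V := hq ▸ hγ.head_tail_mem_V h (hq ▸ hqb)
  refine ⟨Finset.ne_empty_of_mem hqV, ?_⟩
  rcases hγ.head_tail h with hd | hp
  · exact Or.inl ⟨hq.symm.trans hd, hγ.cons_tail.canE_of_head h hne hd⟩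
  · exact Or.inr ⟨hq.symm.trans hp, hγ.swap_canE_of_head_stepP h hp⟩

/-- **The Markov property at time `n`, bijective form: the Peano paths of `S` with the prefix
`a, q₁, …, q_n` (not reaching `b`) correspond exactly to the Peano paths of the data peeled
along the prefix, by `γ ↦ γ[n, ℓ+1]`** ([LSW04] Lemma 4.1). The prefix must occur
(`hne`). [cite: LawlerSchrammWerner2004, Lemma 4.1] -/
noncomputable def Good.prefixEquiv : ∀ (w : List (ℤ × ℤ)) (S : PeelData) (_ : S.Good)
    (_ : ∃ γ, S.IsPath γ ∧ w <+: γ.tail) (_ : S.b ∉ w),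
    {γ // S.IsPath γ ∧ w <+: γ.tail} ≃ {l // (S.peelAlong w).IsPath l}
  | [], _, _, _, _ => Equiv.subtypeEquivRight fun γ ↦ by simp
  | q :: w, S, h, hne, hb =>
    have hf : S.V ≠ ∅ ∧ ((q = stepD S.a ∧ S.CanE) ∨ (q = stepP S.a ∧ S.swap.CanE)) :=
      let ⟨_, hγ, hw⟩ := hne
      h.first_step_facts hγ hw hb
    have hb' : S.b ∉ w := fun h' ↦ hb (List.mem_cons_of_mem _ h')
    if hqd : q = stepD S.a then
      have hE : S.CanE := (hf.2.resolve_right fun h' ↦ stepD_ne_stepP S.a (hqd.symm.trans h'.1)).2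
      have hne' : ∃ γ, S.peelE.IsPath γ ∧ w <+: γ.tail :=
        let ⟨γ, hγ, hw⟩ := hne
        ⟨(h.prefixStepEquivE hf.1 hE w ⟨γ, hγ, hqd ▸ hw⟩).1,
          (h.prefixStepEquivE hf.1 hE w ⟨γ, hγ, hqd ▸ hw⟩).2⟩
      ((Equiv.subtypeEquivRight fun γ ↦ by rw [hqd]).trans (h.prefixStepEquivE hf.1 hE w)).trans <|
        (prefixEquiv w S.peelE (h.peelE hE (h.stepD_ne_b hf.1 hE)) hne' hb').trans
          (pathsCast (peelAlong_cons_of_eq S w hqd).symm)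
    else
      have hqp : q = stepP S.a ∧ S.swap.CanE := hf.2.resolve_left fun h' ↦ hqd h'.1
      have hb'' : stepD S.swap.a ≠ S.swap.b := h.swap.stepD_ne_b (swap_V_ne_empty hf.1) hqp.2
      have hne' : ∃ γ, S.peelP.IsPath γ ∧ w <+: γ.tail :=
        let ⟨γ, hγ, hw⟩ := hne
        ⟨(h.prefixStepEquivP hf.1 hqp.2 w ⟨γ, hγ, hqp.1 ▸ hw⟩).1,
          (h.prefixStepEquivP hf.1 hqp.2 w ⟨γ, hγ, hqp.1 ▸ hw⟩).2⟩
      ((Equiv.subtypeEquivRight fun γ ↦ by rw [hqp.1]).trans (h.prefixStepEquivP hf.1 hqp.2 w)).trans <|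
        (prefixEquiv w S.peelP (h.peelP_good hqp.2 hb'') hne' (by rwa [peelP_b])).trans
          (pathsCast (peelAlong_cons_of_ne S w hqd).symm)

/-- `prefixEquiv` is `γ ↦ γ[n, ℓ+1]` on vertex lists. [folklore] -/
theorem Good.prefixEquiv_apply_val : ∀ (w : List (ℤ × ℤ)) (S : PeelData) (h : S.Good)
    (hne : ∃ γ, S.IsPath γ ∧ w <+: γ.tail) (hb : S.b ∉ w) (γ : {γ // S.IsPath γ ∧ w <+: γ.tail}),
    (Good.prefixEquiv w S h hne hb γ).1 = γ.1.drop w.length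
  | [], _, _, _, _, _ => rfl
  | q :: w, S, h, hne, hb, γ => by
    rw [Good.prefixEquiv]
    split_ifs with hqd
    · simp only [Equiv.trans_apply, pathsCast_apply_val]
      rw [prefixEquiv_apply_val]
      simp only [Good.prefixStepEquivE, Equiv.coe_fn_mk, Equiv.subtypeEquivRight_apply_coe,
        List.length_cons, List.drop_tail]
    · simp only [Equiv.trans_apply, pathsCast_apply_val]
      rw [prefixEquiv_apply_val]
      simp only [Good.prefixStepEquivP, Equiv.coe_fn_mk, Equiv.subtypeEquivRight_apply_coe,
        List.length_cons, List.drop_tail]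

/-- **The Markov property at time `n`, counting form**: there are as many Peano paths of `S`
with a given (occurring) prefix `a, q₁, …, q_n` as Peano paths of the peeled data.
[cite: LawlerSchrammWerner2004, Lemma 4.1] -/
theorem Good.card_prefix_eq (h : S.Good) {w : List (ℤ × ℤ)} (hne : ∃ γ, S.IsPath γ ∧ w <+: γ.tail)
    (hb : S.b ∉ w) :
    Nat.card {γ // S.IsPath γ ∧ w <+: γ.tail} = Nat.card {l // (S.peelAlong w).IsPath l} :=
  Nat.card_congr (Good.prefixEquiv w S h hne hb)

/-- **The Markov property at time `n`, conditional form** ([LSW04] Lemma 4.1: "conditioned on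
`γ[0, n]`, the distribution of the remaining path is the same as that of the UST Peano path from
`γ(n)` to `b` in `D_n`"): for every property `P` of the remainder, the Peano paths of `S` with
the prefix `a, q₁, …, q_n` whose remainder `γ[n, ℓ+1]` satisfies `P` are as many as the Peano
paths of the peeled data satisfying `P` — so that under the uniform law the conditional law of
the remainder given the prefix is uniform on the Peano paths of `S.peelAlong [q₁, …, q_n]`.
[cite: LawlerSchrammWerner2004, Lemma 4.1] -/
theorem Good.card_prefix_and_eq (h : S.Good) {w : List (ℤ × ℤ)} (hne : ∃ γ, S.IsPath γ ∧ w <+: γ.tail)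
    (hb : S.b ∉ w) (P : List (ℤ × ℤ) → Prop) :
    Nat.card {γ : {γ // S.IsPath γ ∧ w <+: γ.tail} // P (γ.1.drop w.length)} =
      Nat.card {l : {l // (S.peelAlong w).IsPath l} // P l.1} :=
  Nat.card_congr ((Good.prefixEquiv w S h hne hb).subtypeEquiv fun γ ↦ by
    rw [Good.prefixEquiv_apply_val])

/-! ### The tree along a prefix -/

/-- The root set grows under the dual step. [folklore] -/
theorem Good.roots_subset_roots_peelE (h : S.Good) (hE : S.CanE) (hb : stepD S.a ≠ S.b)
    (P₀ : Finset (ℤ × ℤ)) : S.roots P₀ ⊆ S.peelE.roots P₀ := by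
  intro u hu
  by_cases hn : farP S.a ∈ S.α
  · obtain ⟨t, ht⟩ := hE.2.resolve_left fun h' ↦ h' hn
    rwa [h.roots_peelE_of_eq hE hb ht]
  · exact (h.mem_roots_peelE_of_notMem hE hb hn).2 (Or.inr hu)

/-- **The root set only grows along a prefix** (the wired part `α_n ⊇ α`). [folklore] -/
theorem Good.roots_subset_roots_peelAlong : ∀ (w : List (ℤ × ℤ)) (S : PeelData) (_ : S.Good)
    (γ : List (ℤ × ℤ)) (_ : S.IsPath γ) (_ : w <+: γ.tail) (_ : S.b ∉ w) (P₀ : Finset (ℤ × ℤ)),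
    S.roots P₀ ⊆ (S.peelAlong w).roots P₀
  | [], _, _, _, _, _, _, _ => Finset.Subset.refl _
  | q :: w, S, h, γ, hγ, hw, hb, P₀ => by
    obtain ⟨hV, hf⟩ := h.first_step_facts hγ hw hb
    obtain ⟨t, ht, hwt⟩ := List.cons_prefix_iff.1 hw
    have hne : γ.tail ≠ [] := hγ.tail_ne_nil h
    have hb' : S.b ∉ w := fun h' ↦ hb (List.mem_cons_of_mem _ h')
    have hwt' : w <+: γ.tail.tail := by rw [ht]; exact hwt
    rcases hf with ⟨hqd, hE⟩ | ⟨hqp, hE'⟩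
    · have hd : γ.tail.head hne = stepD S.a := by simp [ht, hqd]
      rw [peelAlong_cons_of_eq _ _ hqd]
      exact (h.roots_subset_roots_peelE hE (h.stepD_ne_b hV hE) P₀).trans
        (roots_subset_roots_peelAlong w S.peelE (h.peelE hE (h.stepD_ne_b hV hE)) γ.tail
          (hγ.cons_tail.tail_peelE h hne hd) hwt' hb' P₀)
    · have hp : γ.tail.head hne = stepP S.a := by simp [ht, hqp]
      have hb'' : stepD S.swap.a ≠ S.swap.b := h.swap.stepD_ne_b (swap_V_ne_empty hV) hE'
      rw [peelAlong_cons_of_ne _ _ fun e ↦ stepD_ne_stepP S.a (e.symm.trans hqp),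
        ← h.roots_peelP hE' hb'' P₀]
      exact roots_subset_roots_peelAlong w S.peelP (h.peelP_good hE' hb'') γ.tail
        (hγ.tail_peelP h hp) hwt' (by rwa [peelP_b]) P₀

/-- The ambient set only shrinks along a prefix. [folklore] -/
theorem Good.amb_peelAlong_subset : ∀ (w : List (ℤ × ℤ)) (S : PeelData) (_ : S.Good)
    (γ : List (ℤ × ℤ)) (_ : S.IsPath γ) (_ : w <+: γ.tail) (_ : S.b ∉ w), (S.peelAlong w).amb ⊆ S.amb
  | [], _, _, _, _, _, _ => Finset.Subset.refl _
  | q :: w, S, h, γ, hγ, hw, hb => by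
    obtain ⟨hV, hf⟩ := h.first_step_facts hγ hw hb
    obtain ⟨t, ht, hwt⟩ := List.cons_prefix_iff.1 hw
    have hne : γ.tail ≠ [] := hγ.tail_ne_nil h
    have hb' : S.b ∉ w := fun h' ↦ hb (List.mem_cons_of_mem _ h')
    have hwt' : w <+: γ.tail.tail := by rw [ht]; exact hwt
    rcases hf with ⟨hqd, hE⟩ | ⟨hqp, hE'⟩
    · have hd : γ.tail.head hne = stepD S.a := by simp [ht, hqd]
      rw [peelAlong_cons_of_eq _ _ hqd]
      exact (amb_peelAlong_subset w S.peelE (h.peelE hE (h.stepD_ne_b hV hE)) γ.tail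
        (hγ.cons_tail.tail_peelE h hne hd) hwt' hb').trans (h.amb_peelE_subset hE (h.stepD_ne_b hV hE))
    · have hp : γ.tail.head hne = stepP S.a := by simp [ht, hqp]
      have hb'' : stepD S.swap.a ≠ S.swap.b := h.swap.stepD_ne_b (swap_V_ne_empty hV) hE'
      rw [peelAlong_cons_of_ne _ _ fun e ↦ stepD_ne_stepP S.a (e.symm.trans hqp)]
      exact (amb_peelAlong_subset w S.peelP (h.peelP_good hE' hb'') γ.tail (hγ.tail_peelP h hp) hwt'
        (by rwa [peelP_b])).trans (h.amb_peelP_subset hE' hb'')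

/-- **The tree along a prefix, off the new roots: `T(γ)` is the tree of the remainder.** For a
Peano path `γ` of `S` with the prefix `a, q₁, …, q_n` and the data `S' = S.peelAlong [q₁, …, q_n]`
peeled along it, the parent map of `T(γ)` agrees off the roots of `S'` with that of the forest
`T'(γ[n, ℓ+1])` of the remainder. (Stated for any `S'` equal to the peeled data, to ease
rewriting.) [cite: LawlerSchrammWerner2004, Lemma 4.1] -/
theorem Good.pathForestEquiv_parent_peelAlong : ∀ (w : List (ℤ × ℤ)) (S : PeelData) (h : S.Good)
    (hP : S.amb ⊆ P₀) (γ : {l // S.IsPath l}) (_ : w <+: γ.1.tail) (_ : S.b ∉ w)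
    (S' : PeelData) (_ : S.peelAlong w = S') (h' : S'.Good) (hP' : S'.amb ⊆ P₀)
    (hγ' : S'.IsPath (γ.1.drop w.length)) (v : ↥P₀), v ∉ S'.roots P₀ →
      (Good.pathForestEquiv S h hP γ).parent v =
        (Good.pathForestEquiv S' h' hP' ⟨γ.1.drop w.length, hγ'⟩).parent v
  | [], S, h, hP, γ, _, _, S', hS', h', hP', hγ', v, _ => by
    subst hS'
    rfl
  | q :: w, S, h, hP, γ, hw, hb, S', hS', h', hP', hγ', v, hv => by
    obtain ⟨hV, hf⟩ := h.first_step_facts γ.2 hw hb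
    obtain ⟨t, ht, hwt⟩ := List.cons_prefix_iff.1 hw
    have hne : γ.1.tail ≠ [] := γ.2.tail_ne_nil h
    have hb' : S.b ∉ w := fun h' ↦ hb (List.mem_cons_of_mem _ h')
    have hwt' : w <+: γ.1.tail.tail := by rw [ht]; exact hwt
    have hγ'' : S'.IsPath (γ.1.tail.drop w.length) := by
      rwa [List.length_cons, ← List.drop_tail] at hγ'
    have heq : (⟨γ.1.drop (q :: w).length, hγ'⟩ : {l // S'.IsPath l}) =
        ⟨γ.1.tail.drop w.length, hγ''⟩ := Subtype.ext List.drop_tail.symm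
    rw [heq]
    rcases hf with ⟨hqd, hE⟩ | ⟨hqp, hE'⟩
    · have hd : γ.1.tail.head hne = stepD S.a := by simp [ht, hqd]
      have hb₀ : stepD S.a ≠ S.b := h.stepD_ne_b hV hE
      have hS₁ : S.peelE.peelAlong w = S' := by rw [← hS', peelAlong_cons_of_eq _ _ hqd]
      rw [h.pathForestEquiv_parent_of_stepD hP hV γ hd v, if_neg]
      · exact pathForestEquiv_parent_peelAlong w S.peelE (h.peelE hE hb₀)
          ((h.amb_peelE_subset hE hb₀).trans hP) ⟨γ.1.tail, γ.2.cons_tail.tail_peelE h hne hd⟩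
          hwt' hb' S' hS₁ h' hP' hγ'' v hv
      · rintro ⟨rfl, hn⟩
        refine hv ?_
        rw [← hS₁]
        refine roots_subset_roots_peelAlong w S.peelE (h.peelE hE hb₀) γ.1.tail
          (γ.2.cons_tail.tail_peelE h hne hd) hwt' hb' P₀ ?_
        rw [h.mem_roots_peelE_of_notMem hE hb₀ hn]
        exact Or.inl rfl
    · have hp : γ.1.tail.head hne = stepP S.a := by simp [ht, hqp]
      have hb'' : stepD S.swap.a ≠ S.swap.b := h.swap.stepD_ne_b (swap_V_ne_empty hV) hE'
      have hS₁ : S.peelP.peelAlong w = S' := by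
        rw [← hS', peelAlong_cons_of_ne _ _ fun e ↦ stepD_ne_stepP S.a (e.symm.trans hqp)]
      rw [h.pathForestEquiv_parent_of_stepP hP hV γ hp]
      exact pathForestEquiv_parent_peelAlong w S.peelP (h.peelP_good hE' hb'')
        ((h.amb_peelP_subset hE' hb'').trans hP) ⟨γ.1.tail, γ.2.tail_peelP h hp⟩ hwt'
        (by rwa [peelP_b]) S' hS₁ h' hP' hγ'' v hv

/-- **The tree along a prefix, on the new roots: determined by the prefix.** Two Peano paths of
`S` with the same prefix `a, q₁, …, q_n` have trees `T(γ₁)`, `T(γ₂)` with the same parents at the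
roots of the peeled data (the vertices of `α_n`: the edges added alongside the dual steps of the
prefix, and `α`). [cite: LawlerSchrammWerner2004, Lemma 4.1] -/
theorem Good.pathForestEquiv_parent_eq_of_prefix : ∀ (w : List (ℤ × ℤ)) (S : PeelData)
    (h : S.Good) (hP : S.amb ⊆ P₀) (γ₁ γ₂ : {l // S.IsPath l}) (_ : w <+: γ₁.1.tail)
    (_ : w <+: γ₂.1.tail) (_ : S.b ∉ w) (v : ↥P₀), v ∈ (S.peelAlong w).roots P₀ →
      (Good.pathForestEquiv S h hP γ₁).parent v = (Good.pathForestEquiv S h hP γ₂).parent v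
  | [], S, h, hP, γ₁, γ₂, _, _, _, v, hv => by
    rw [peelAlong_nil] at hv
    rw [(Good.pathForestEquiv S h hP γ₁).root hv, (Good.pathForestEquiv S h hP γ₂).root hv]
  | q :: w, S, h, hP, γ₁, γ₂, hw₁, hw₂, hb, v, hv => by
    obtain ⟨hV, hf⟩ := h.first_step_facts γ₁.2 hw₁ hb
    obtain ⟨t₁, ht₁, hwt₁⟩ := List.cons_prefix_iff.1 hw₁
    obtain ⟨t₂, ht₂, hwt₂⟩ := List.cons_prefix_iff.1 hw₂
    have hne₁ : γ₁.1.tail ≠ [] := γ₁.2.tail_ne_nil h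
    have hne₂ : γ₂.1.tail ≠ [] := γ₂.2.tail_ne_nil h
    have hb' : S.b ∉ w := fun h' ↦ hb (List.mem_cons_of_mem _ h')
    have hwt₁' : w <+: γ₁.1.tail.tail := by rw [ht₁]; exact hwt₁
    have hwt₂' : w <+: γ₂.1.tail.tail := by rw [ht₂]; exact hwt₂
    rcases hf with ⟨hqd, hE⟩ | ⟨hqp, hE'⟩
    · have hd₁ : γ₁.1.tail.head hne₁ = stepD S.a := by simp [ht₁, hqd]
      have hd₂ : γ₂.1.tail.head hne₂ = stepD S.a := by simp [ht₂, hqd]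
      have hb₀ : stepD S.a ≠ S.b := h.stepD_ne_b hV hE
      rw [h.pathForestEquiv_parent_of_stepD hP hV γ₁ hd₁ v,
        h.pathForestEquiv_parent_of_stepD hP hV γ₂ hd₂ v]
      split_ifs with hc
      · rfl
      · rw [peelAlong_cons_of_eq _ _ hqd] at hv
        exact pathForestEquiv_parent_eq_of_prefix w S.peelE (h.peelE hE hb₀)
          ((h.amb_peelE_subset hE hb₀).trans hP) ⟨γ₁.1.tail, γ₁.2.cons_tail.tail_peelE h hne₁ hd₁⟩
          ⟨γ₂.1.tail, γ₂.2.cons_tail.tail_peelE h hne₂ hd₂⟩ hwt₁' hwt₂' hb' v hv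
    · have hp₁ : γ₁.1.tail.head hne₁ = stepP S.a := by simp [ht₁, hqp]
      have hp₂ : γ₂.1.tail.head hne₂ = stepP S.a := by simp [ht₂, hqp]
      have hb'' : stepD S.swap.a ≠ S.swap.b := h.swap.stepD_ne_b (swap_V_ne_empty hV) hE'
      rw [h.pathForestEquiv_parent_of_stepP hP hV γ₁ hp₁, h.pathForestEquiv_parent_of_stepP hP hV γ₂ hp₂]
      rw [peelAlong_cons_of_ne _ _ fun e ↦ stepD_ne_stepP S.a (e.symm.trans hqp)] at hv
      exact pathForestEquiv_parent_eq_of_prefix w S.peelP (h.peelP_good hE' hb'')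
        ((h.amb_peelP_subset hE' hb'').trans hP) ⟨γ₁.1.tail, γ₁.2.tail_peelP h hp₁⟩
        ⟨γ₂.1.tail, γ₂.2.tail_peelP h hp₂⟩ hwt₁' hwt₂' (by rwa [peelP_b]) v hv

/-- **The tree along a prefix, packaged**: for Peano paths `γ` of `S` with the prefix
`a, q₁, …, q_n` the parent map of `T(γ)` is that of the tree `T(γ₀)` of one fixed such path on
the roots of the peeled data `S'`, and that of the tree of the remainder `γ[n, ℓ+1]` (a Peano
path of `S'`) off them. [cite: LawlerSchrammWerner2004, Lemma 4.1] -/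
theorem Good.pathForestEquiv_parent_prefix (h : S.Good) (hP : S.amb ⊆ P₀) {w : List (ℤ × ℤ)}
    (γ₀ γ : {l // S.IsPath l}) (hw₀ : w <+: γ₀.1.tail) (hw : w <+: γ.1.tail) (hb : S.b ∉ w)
    (S' : PeelData) (hS' : S.peelAlong w = S') (h' : S'.Good) (hP' : S'.amb ⊆ P₀)
    (hγ' : S'.IsPath (γ.1.drop w.length)) (v : ↥P₀) :
    (Good.pathForestEquiv S h hP γ).parent v =
      if v ∈ S'.roots P₀ then (Good.pathForestEquiv S h hP γ₀).parent v
      else (Good.pathForestEquiv S' h' hP' ⟨γ.1.drop w.length, hγ'⟩).parent v := by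
  split_ifs with hv
  · subst hS'
    exact Good.pathForestEquiv_parent_eq_of_prefix w S h hP γ γ₀ hw hw₀ hb v hv
  · exact Good.pathForestEquiv_parent_peelAlong w S h hP γ hw hb S' hS' h' hP' hγ' v hv

end PeelData

end USTPeano

end Literature.Probability.RandomPlanarGeometry
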